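/-
Copyright (c) 2026. Released under Apache 2.0 license.
-/
import Summits.RiemannHypothesis.RiemannHypothesis.Theorems.MotivicDoorSemilocalQuinticDensity
import Summits.RiemannHypothesis.RiemannHypothesis.Theorems.MotivicDoorSemilocalQuinticKernel
import Literature.NumberTheory.LFunctions.WeilSemilocalWindow
import Literature.Analysis.SpecialFunctions.EulerMascheroniBounds
import HarnessLib

/-!
# Motivic door, semi-local ladder — cell, tail and constant estimates for the quintic certificate

Pub speedrun, cell `pub-rhdoor`, seat `lad-2`, generation 4 (file 5 of the rung R3⁻(0.59) chain).
The analytic inequalities that reduce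
`∫₀^∞ w(t) D_t(G) dt` (quintic witness `G`, `MotivicDoorSemilocalQuinticWitness.lean`) to the
kernel-checked numbers of `MotivicDoorSemilocalQuinticKernel.lean`:

* `cell_le`: on a cell `[a_i, a_{i+1}]`, `a_i = i/2000`, `i ≥ 1`:
  `∫ w D ≤ 2b² · w(a_i)(IΔ(τ_{i+1}) - IΔ(τ_i)) = 2b² · cellR i` (`w` antitone, `D = 2bΔ(t/b) ≥ 0`,
  exact polynomial antiderivative);
* `cell_zero_le`: `∫₀^{a_1} w D ≤ 0.0336` (from `w(t) ≤ 1/(2t) + 1`, exact rational integral);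
* `tail_le`: `∫_{2b}^∞ w D ≤ 2N · T(e^{-b})`;
* `kSum_le_killing`: `K_200 ≤ ∫₀^∞ (e^{t/2} - 1)/(2 sinh t) dt` (partial geometric series);
* `const_le_semilocalTwoConstant`: `4.0884869 + 2 K_200 ≤ C₂`.

PROVED: everything stated (sorry-free, standard axioms).
-/

set_option linter.dupNamespace false

noncomputable section

open MeasureTheory Set Filter Topology Real Finset
open Literature.NumberTheory.LFunctions
open Literature.Analysis.ValidatedNumerics.Numerics

namespace Summit.RiemannHypothesis.RiemannHypothesis.Theorems.MotivicDoor.SemilocalQuintic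

open SemilocalMarkov SemilocalKernel GroundStateSimpleEven

/-! ## Bridging the two Horner evaluations -/

/-- The kernel file's `hornerR` is this file's `polyR`. -/
theorem hornerR_eq_polyR : ∀ (l : List ℚ) (x : ℝ), hornerR l x = polyR l x
  | [], _ => rfl
  | c :: l, x => by
      show (c : ℝ) + x * hornerR l x = (c : ℝ) + x * polyR l x
      rw [hornerR_eq_polyR l x]

/-- The kernel's coefficient list `dL` is the witness file's. -/
theorem kernel_dL : SemilocalKernel.dL = SemilocalQuintic.dL := rfl

/-- `∫ᵤᵛ Δ = IΔ(v) - IΔ(u)`. -/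
theorem integral_polyR_dL (u v : ℝ) :
    ∫ τ in u..v, polyR SemilocalQuintic.dL τ = hornerR iL v - hornerR iL u := by
  rw [integral_polyR]
  simp only [SemilocalQuintic.dL, SemilocalQuintic.qL, iL, hornerR, List.length_cons,
    List.length_nil, Finset.sum_range_succ, Finset.sum_range_zero, List.getD_cons_succ,
    List.getD_cons_zero]
  push_cast
  ring

/-! ## The grid and the cells `i ≥ 1` -/

/-- Grid point `a_i = i / 2000`. -/
def ag (i : ℕ) : ℝ := (i : ℝ) / 2000

/-- `a_{2356} = 2b`. -/
theorem ag_last : ag 2356 = 2 * bQ := by unfold ag bQ; norm_num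

/-- `a_0 = 0`. -/
theorem ag_zero : ag 0 = 0 := by unfold ag; norm_num

/-- On the cell `[a_i, a_{i+1}]`, `1 ≤ i ≤ 2355`:  `∫ w D ≤ 2 b² cellR i`. -/
theorem cell_le {i : ℕ} (hi : 1 ≤ i) (hi' : i + 1 ≤ 2356) :
    ∫ t in ag i..ag (i + 1), weilArchDensity t * weilIncrement GQ t ≤ 2 * bQ ^ 2 * cellR i := by
  have hb := bQ_pos
  have hi1 : (1 : ℝ) ≤ i := by exact_mod_cast hi
  have hi2 : ((i : ℝ) + 1) ≤ 2356 := by exact_mod_cast hi'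
  have hai : 0 < ag i := by unfold ag; positivity
  have hle : ag i ≤ ag (i + 1) := by unfold ag; push_cast; linarith
  have htop : ag (i + 1) ≤ 2 * bQ := by unfold ag bQ; push_cast; linarith
  have hf : IntervalIntegrable (fun t ↦ weilArchDensity t * weilIncrement GQ t) volume
      (ag i) (ag (i + 1)) :=
    (intervalIntegrable_iff_integrableOn_Ioc_of_le hle).2
      (integrableOn_w_mul_weilIncrement_GQ.mono_set fun t ht ↦ lt_trans hai ht.1)
  have hgc : Continuous fun t ↦ weilArchDensity (ag i) * (2 * bQ * polyR SemilocalQuintic.dL (t / bQ)) :=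
    continuous_const.mul (continuous_const.mul
      ((continuous_polyR _).comp (continuous_id.div_const _)))
  have hmono := intervalIntegral.integral_mono_on hle hf (hgc.intervalIntegrable _ _)
    (fun t ht ↦ by
      have ht0 : 0 < t := lt_of_lt_of_le hai ht.1
      have ht2 : t ≤ 2 * bQ := ht.2.trans htop
      rw [weilIncrement_GQ_eq ht0.le ht2]
      have hw : weilArchDensity t ≤ weilArchDensity (ag i) :=
        weilArchDensity_antitoneOn hai (mem_Ioi.2 ht0) ht.1
      have hΔ : 0 ≤ 2 * bQ * polyR SemilocalQuintic.dL (t / bQ) :=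
        mul_nonneg (by positivity) (polyR_dL_nonneg (by positivity)
          (by rw [div_le_iff₀ hb]; linarith))
      exact mul_le_mul_of_nonneg_right hw hΔ)
  refine hmono.trans (le_of_eq ?_)
  rw [intervalIntegral.integral_const_mul, intervalIntegral.integral_const_mul,
    intervalIntegral.integral_comp_div (fun τ ↦ polyR SemilocalQuintic.dL τ) hb.ne',
    integral_polyR_dL, smul_eq_mul, tuf_weilArchDensity_eq_z hai, cellR, wR]
  have e1 : ag i / bQ = (i : ℝ) / 1178 := by unfold ag bQ; field_simp; ring
  have e2 : ag (i + 1) / bQ = ((i : ℝ) + 1) / 1178 := by unfold ag bQ; push_cast; field_simp; ring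
  have e3 : ag i / 2 = (i : ℝ) / 2000 / 2 := by unfold ag; rfl
  rw [e1, e2]
  unfold ag
  ring

/-! ## The cell at the origin -/

/-- Coefficients of `(1 + 2bτ) q(τ)`. -/
def e0L : List ℚ := [64, 925924/125, -2551339/375, -7026829/750, 532023/50, 295089/1000,
  -27621/28, -16268769/14000, 765/4, 90117/400, -567/44, -333963/22000]

/-- `(1 + 2bτ) q(τ) = polyR e0L τ`. -/
theorem e0L_identity (τ : ℝ) : (1 + 2 * bQ * τ) * polyR SemilocalQuintic.qL τ = polyR e0L τ := by
  simp only [polyR, SemilocalQuintic.qL, e0L, bQ]; push_cast; ring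

/-- `q ≥ 0` on `(0, 2]`. -/
theorem polyR_qL_nonneg {τ : ℝ} (h0 : 0 < τ) (h2 : τ ≤ 2) : 0 ≤ polyR SemilocalQuintic.qL τ := by
  have h := polyR_dL_nonneg h0.le h2
  rw [polyR_dL] at h
  exact (mul_nonneg_iff_of_pos_left h0).1 h

/-- `q(0) = 64`. -/
theorem polyR_qL_zero : polyR SemilocalQuintic.qL 0 = 64 := by
  simp [polyR, SemilocalQuintic.qL]

/-- The cell at the origin: `∫₀^{a_1} w D ≤ 0.0336`. -/
theorem cell_zero_le :
    ∫ t in ag 0..ag 1, weilArchDensity t * weilIncrement GQ t ≤ 336 / 10000 := by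
  have hb := bQ_pos
  rw [ag_zero]
  have ha1 : ag 1 = 1 / 2000 := by unfold ag; norm_num
  have hle : (0 : ℝ) ≤ ag 1 := by rw [ha1]; norm_num
  have hf : IntervalIntegrable (fun t ↦ weilArchDensity t * weilIncrement GQ t) volume 0 (ag 1) :=
    (intervalIntegrable_iff_integrableOn_Ioc_of_le hle).2
      (integrableOn_w_mul_weilIncrement_GQ.mono_set fun t ht ↦ ht.1)
  set g0 : ℝ → ℝ := fun τ ↦ (1 + 2 * bQ * τ) * polyR SemilocalQuintic.qL τ with hg0
  have hgc : Continuous fun t ↦ g0 (t / bQ) := by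
    rw [hg0]
    exact ((continuous_const.add (continuous_const.mul continuous_id)).mul
      (continuous_polyR _)).comp (continuous_id.div_const _)
  have hmono := intervalIntegral.integral_mono_on hle hf (hgc.intervalIntegrable _ _)
    (fun t ht ↦ by
      have ht2 : t ≤ 2 * bQ := by rw [ha1] at ht; unfold bQ; linarith [ht.2]
      rw [weilIncrement_GQ_eq ht.1 ht2, polyR_dL]
      rcases ht.1.eq_or_lt with h0 | h0
      · subst h0
        simp only [zero_div, zero_mul, mul_zero, hg0, polyR_qL_zero]; norm_num
      · have hτ2 : t / bQ ≤ 2 := by rw [div_le_iff₀ hb]; linarith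
        have hq := polyR_qL_nonneg (div_pos h0 hb) hτ2
        have hw := mul_weilArchDensity_le h0
        simp only [hg0]
        have : weilArchDensity t * (2 * bQ * (t / bQ * polyR SemilocalQuintic.qL (t / bQ)))
            = 2 * (t * weilArchDensity t) * polyR SemilocalQuintic.qL (t / bQ) := by
          field_simp
        rw [this, show (1 + 2 * bQ * (t / bQ)) = 2 * (1 / 2 + t) by field_simp]
        exact mul_le_mul_of_nonneg_right (by linarith) hq)
  refine hmono.trans ?_
  rw [intervalIntegral.integral_comp_div g0 hb.ne', zero_div, hg0]
  simp_rw [e0L_identity]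
  rw [integral_polyR, smul_eq_mul, ha1]
  simp only [e0L, List.length_cons, List.length_nil, Finset.sum_range_succ, Finset.sum_range_zero,
    List.getD_cons_succ, List.getD_cons_zero, bQ]
  norm_num

/-! ## The tail `t ≥ 2b` -/

/-- The tail: `∫_{2b}^∞ w D ≤ 2N · T(e^{-b})`. -/
theorem tail_le :
    ∫ t in Ioi (2 * bQ), weilArchDensity t * weilIncrement GQ t
      ≤ 2 * NQ * tailT (Real.exp (-bQ)) := by
  have hb := bQ_pos
  have hN : 0 ≤ 2 * NQ := by unfold NQ n2Q bQ; norm_num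
  set e := Real.exp (-bQ) with he
  have he4 : e ^ 4 = Real.exp (-(2 * (2 * bQ))) := by rw [he, ← Real.exp_nat_mul]; ring_nf
  have he4' : e ^ 4 < 1 := by rw [he4]; exact Real.exp_lt_one_iff.2 (by linarith)
  -- the majorant
  set m : ℝ → ℝ := fun t ↦ 2 * NQ * (Real.exp (-(1 / 2) * t) + Real.exp (-(5 / 2) * t)
      + Real.exp (-(9 / 2) * t) / (1 - e ^ 4)) with hm
  have hmi : IntegrableOn m (Ioi (2 * bQ)) := by
    rw [hm]
    refine Integrable.const_mul ((Integrable.add ?_ ?_).add ?_) _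
    · exact exp_neg_integrableOn_Ioi _ (by norm_num)
    · exact exp_neg_integrableOn_Ioi _ (by norm_num)
    · exact (exp_neg_integrableOn_Ioi _ (by norm_num)).div_const _
  have hfi : IntegrableOn (fun t ↦ weilArchDensity t * weilIncrement GQ t) (Ioi (2 * bQ)) :=
    integrableOn_w_mul_weilIncrement_GQ.mono_set (Ioi_subset_Ioi (by linarith))
  have hmono : ∫ t in Ioi (2 * bQ), weilArchDensity t * weilIncrement GQ t
      ≤ ∫ t in Ioi (2 * bQ), m t := by
    refine setIntegral_mono_on hfi hmi measurableSet_Ioi fun t (ht : 2 * bQ < t) ↦ ?_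
    have ht0 : 0 < t := by linarith
    rw [weilIncrement_GQ_eq_of_lt ht, hm]
    simp only
    rw [mul_comm (weilArchDensity t)]
    refine mul_le_mul_of_nonneg_left ?_ hN
    have h := weilArchDensity_le_tail (by linarith : 0 < 2 * bQ) ht.le
    rw [← he4] at h
    have a1 : Real.exp (-(1 / 2) * t) = Real.exp (-(t / 2)) := by congr 1; ring
    have a5 : Real.exp (-(5 / 2) * t) = Real.exp (-(5 * t / 2)) := by congr 1; ring
    have a9 : Real.exp (-(9 / 2) * t) = Real.exp (-(9 * t / 2)) := by congr 1; ring
    rw [a1, a5, a9]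
    exact h
  refine hmono.trans (le_of_eq ?_)
  rw [hm, integral_const_mul]
  congr 1
  rw [integral_add, integral_add, integral_div, integral_exp_mul_Ioi (by norm_num),
    integral_exp_mul_Ioi (by norm_num), integral_exp_mul_Ioi (by norm_num)]
  · simp only [tailT]
    have e5 : Real.exp (-(5 / 2) * (2 * bQ)) = e * e ^ 4 := by
      rw [he, ← pow_succ', ← Real.exp_nat_mul]; ring_nf
    have e9 : Real.exp (-(9 / 2) * (2 * bQ)) = e * (e ^ 4) ^ 2 := by
      rw [he, ← pow_mul, ← pow_succ', ← Real.exp_nat_mul]; ring_nf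
    have e1 : Real.exp (-(1 / 2) * (2 * bQ)) = e := by rw [he]; ring_nf
    rw [e1, e5, e9]
    ring
  · exact exp_neg_integrableOn_Ioi _ (by norm_num)
  · exact exp_neg_integrableOn_Ioi _ (by norm_num)
  · exact (exp_neg_integrableOn_Ioi _ (by norm_num)).add (exp_neg_integrableOn_Ioi _ (by norm_num))
  · exact (exp_neg_integrableOn_Ioi _ (by norm_num)).div_const _

/-! ## The killing integral -/

/-- Partial geometric minorant of the killing density: for `t > 0`,
`Σ_{m<M} (e^{-(2m+½)t} - e^{-(2m+1)t}) ≤ (e^{t/2} - 1)/(2 sinh t)`. -/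
theorem killing_minorant (M : ℕ) {t : ℝ} (ht : 0 < t) :
    ∑ m ∈ range M, (Real.exp (-(2 * m + 1 / 2) * t) - Real.exp (-(2 * m + 1) * t))
      ≤ (Real.exp (t / 2) - 1) / (2 * Real.sinh t) := by
  set s := Real.exp (-(t / 2)) with hs
  have hs0 : 0 < s := Real.exp_pos _
  have hs1 : s < 1 := Real.exp_lt_one_iff.2 (by linarith)
  have hq1 : s ^ 4 < 1 := pow_lt_one₀ hs0.le hs1 (by norm_num)
  have hterm : ∀ m : ℕ, Real.exp (-(2 * m + 1 / 2) * t) - Real.exp (-(2 * m + 1) * t)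
      = (s - s ^ 2) * (s ^ 4) ^ m := by
    intro m
    have a : Real.exp (-(2 * m + 1 / 2) * t) = s ^ (4 * m + 1) := by
      rw [hs, ← Real.exp_nat_mul]; congr 1; push_cast; ring
    have b : Real.exp (-(2 * m + 1) * t) = s ^ (4 * m + 2) := by
      rw [hs, ← Real.exp_nat_mul]; congr 1; push_cast; ring
    rw [a, b]; ring
  simp_rw [hterm]
  rw [← Finset.mul_sum]
  have hgeom : ∑ m ∈ range M, (s ^ 4) ^ m ≤ 1 / (1 - s ^ 4) := by
    rw [le_div_iff₀ (by linarith), geom_sum_mul_neg]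
    have : 0 ≤ (s ^ 4) ^ M := by positivity
    linarith
  have hrhs : (Real.exp (t / 2) - 1) / (2 * Real.sinh t) = (s - s ^ 2) * (1 / (1 - s ^ 4)) := by
    rw [Real.sinh_eq]
    have e1 : Real.exp (t / 2) = s⁻¹ := by rw [hs, Real.exp_neg, inv_inv]
    have e2 : Real.exp t = (s ^ 2)⁻¹ := by
      rw [hs, ← Real.exp_nat_mul, ← Real.exp_neg]; congr 1; push_cast; ring
    have e3 : Real.exp (-t) = s ^ 2 := by
      rw [hs, ← Real.exp_nat_mul]; congr 1; push_cast; ring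
    rw [e1, e2, e3]
    have h1q : (1 : ℝ) - s ^ 4 ≠ 0 := (sub_pos.2 hq1).ne'
    field_simp
  rw [hrhs]
  exact mul_le_mul_of_nonneg_left hgeom (by nlinarith)

/-- `K_200 ≤ ∫₀^∞ (e^{t/2} - 1)/(2 sinh t) dt`. -/
theorem kSum_le_killing :
    kSum 200 ≤ ∫ t in Ioi (0 : ℝ), (Real.exp (t / 2) - 1) / (2 * Real.sinh t) := by
  have hint : ∀ m : ℕ, IntegrableOn (fun t ↦ Real.exp (-(2 * m + 1 / 2) * t)
      - Real.exp (-(2 * m + 1) * t)) (Ioi (0 : ℝ)) := fun m ↦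
    (exp_neg_integrableOn_Ioi 0 (by positivity)).sub (exp_neg_integrableOn_Ioi 0 (by positivity))
  have hmi : IntegrableOn (fun t ↦ ∑ m ∈ range 200, (Real.exp (-(2 * m + 1 / 2) * t)
      - Real.exp (-(2 * m + 1) * t))) (Ioi (0 : ℝ)) :=
    integrable_finsetSum _ fun m _ ↦ hint m
  have hmono := setIntegral_mono_on hmi integrableOn_weilKillingDensity measurableSet_Ioi
    fun t ht ↦ killing_minorant 200 ht
  refine le_trans (le_of_eq ?_) hmono
  rw [integral_finsetSum _ fun m _ ↦ hint m, kSum]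
  refine Finset.sum_congr rfl fun m _ ↦ ?_
  rw [integral_sub (exp_neg_integrableOn_Ioi 0 (by positivity))
    (exp_neg_integrableOn_Ioi 0 (by positivity)),
    integral_exp_mul_Ioi (by have := m.cast_nonneg (α := ℝ); linarith : -(2 * (m : ℝ) + 1 / 2) < 0),
    integral_exp_mul_Ioi (by have := m.cast_nonneg (α := ℝ); linarith : -(2 * (m : ℝ) + 1) < 0)]
  simp only [mul_zero, Real.exp_zero]
  have h1 : (4 * (m : ℝ) + 1) ≠ 0 := by positivity
  have h2 : (2 * (m : ℝ) + 1) ≠ 0 := by positivity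
  have h3 : (2 * (m : ℝ) + 1 / 2) ≠ 0 := by positivity
  field_simp
  ring

/-! ## The constant -/

/-- `4.0884869 + 2 K_200 ≤ C₂ = √2 log 2 + log 4π + γ + 2K`. -/
theorem const_le_semilocalTwoConstant :
    (40884869 / 10000000 : ℝ) + 2 * kSum 200 ≤ semilocalTwoConstant := by
  have hK := kSum_le_killing
  have h1 := JensenWindow.sqrt_two_mul_log_two_ge
  have h2 := JensenWindow.log_pi_ge_d5
  have h3 := Literature.Analysis.SpecialFunctions.Real.eulerMascheroniConstant_gt_d8
  have h4 := Real.log_two_gt_d9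
  have e1 : 2 * (Real.log 2 / Real.sqrt 2) = Real.sqrt 2 * Real.log 2 := by
    have hs : Real.sqrt 2 * Real.sqrt 2 = 2 := Real.mul_self_sqrt (by norm_num)
    have hs0 : Real.sqrt 2 ≠ 0 := by positivity
    field_simp
    nlinarith [hs]
  have e2 : Real.log (4 * π) = 2 * Real.log 2 + Real.log π := by
    rw [Real.log_mul (by norm_num) Real.pi_pos.ne', show (4 : ℝ) = 2 ^ 2 by norm_num,
      Real.log_pow]; push_cast; ring
  unfold semilocalTwoConstant
  rw [e1, e2]
  linarith

end Summit.RiemannHypothesis.RiemannHypothesis.Theorems.MotivicDoor.SemilocalQuintic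

end
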